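import Summits.CriticalPhenomena.PercolationContinuityZ3.Theorems.Transplant.BoxProdZ2SeedKitDefs
import HarnessLib

/-!
# The RIM / DEEP dichotomy of a contact in a concentric tube (design (D), §11 v2): behind a contact of a tube level over the window
# `π = B_X(w₀, R)`, either the kit cube's fibre ball has room for the route prism of scale `ℓ` (deep: `B_X(c, ψ ℓ) ⊆ π`), or every vertex of
# the kit cube — hence of its face — has fibre coordinate outside `B_X(w₀, R - L')` (rim: the face belongs to the enlarged target), provided the
# rim allowance is `L' ≥ ψ ℓ + nF`

builds on p205010 (kernel theorem, internal audit signed; external expert review pending) — nothing in this file uses p205010.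
Lane `prim-bschramm`, seat `prim-bschramm-p3` (order I2 of V56: the per-contact `hcon` dichotomy of `kitClause(Q)` for the concentric tube
chains); helper file (`--supports stmt-CriticalPhenomena-4575 --as helper`).

* `deep_or_far` — for a fibre coordinate `w`, `c = fibCtrT X w₀ R nF w`, radii with `ψℓ + nF ≤ L' ≤ R`: `B_X(c, ψℓ) ⊆ B(w₀, R)` or
  `B_X(c, nF) ∩ B(w₀, R - L') = ∅`;
* `kitCube_deep_or_far` — the same for the kit cube `kitCube X w₀ R Lo Hi M nF x` of a contact `x`.
[cite: KozmaNitzan2024, §4 p. 21 (v(P) + Λ_M ⊆ S), Lemma 12 p. 24 (the edge faces of the corridor) — the ℤ^d model has no window]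
-/

noncomputable section

namespace Summit.CriticalPhenomena.PercolationContinuityZ3.Theorems

namespace Transplant

namespace BoxProdZ2

open Literature.Probability.Percolation Literature.Probability.LatticeModels SimpleGraph
open Literature.Barriers.CriticalPhenomena (graphBall graphBall_finite mem_graphBall_self graphBall_mono)

variable {W : Type} [DecidableEq W] (X : SimpleGraph W) [X.LocallyFinite]

omit [DecidableEq W] in
/-- **Deep or far.**  For a fibre coordinate `w` with retracted centre `c = fibCtrT X w₀ R nF w` (relative to the window `B(w₀, R)`) and
radii `ψℓ + nF ≤ L' ≤ R`: either the route ball `B_X(c, ψℓ)` fits in the window, or the cube's fibre ball `B_X(c, nF)` misses `B(w₀, R - L')`.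
[cite: KozmaNitzan2024, §4 p. 21, Lemma 12 p. 24] -/
theorem deep_or_far {w₀ : W} {R nF ψℓ L' : ℕ} (w : W) (hL : ψℓ + nF ≤ L') (hLR : L' ≤ R) :
    ballFin X (fibCtrT X w₀ R nF w) ψℓ ⊆ ballFin X w₀ R ∨
      ∀ b ∈ ballFin X (fibCtrT X w₀ R nF w) nF, b ∉ ballFin X w₀ (R - L') := by
  set c := fibCtrT X w₀ R nF w with hc
  by_cases hdeep : c ∈ graphBall X w₀ (R - ψℓ)
  · left
    intro b hb
    rw [mem_ballFin] at hb ⊢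
    have h := mem_graphBall_add X hdeep hb
    exact graphBall_mono X w₀ (by omega) h
  · right
    intro b hb hb'
    rw [mem_ballFin] at hb hb'
    apply hdeep
    have hcb : c ∈ graphBall X b nF := (mem_graphBall_comm X).1 hb
    have h := mem_graphBall_add X hb' hcb
    exact graphBall_mono X w₀ (by omega) h

omit [DecidableEq W] in
/-- **The kit cube behind a contact is deep or far**: for a contact `x`, either `B_X(c_x, ψℓ) ⊆ B(w₀, R)`
(the deep route of `hcon_of_room(Q)` has fibre room), or every vertex of `kitCube X w₀ R Lo Hi M nF x` has fibre coordinate outside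
`B(w₀, R - L')` (its face lies in the rim part of the enlarged target). [cite: KozmaNitzan2024, §4 p. 21, Lemma 12 p. 24] -/
theorem kitCube_deep_or_far {w₀ : W} {R nF ψℓ L' : ℕ} (Lo Hi : Site 2) (M : ℕ) (x : W × Site 2)
    (hL : ψℓ + nF ≤ L') (hLR : L' ≤ R) :
    ballFin X (fibCtrT X w₀ R nF x.1) ψℓ ⊆ ballFin X w₀ R ∨
      ∀ u ∈ kitCube X w₀ R Lo Hi M nF x, u.1 ∉ ballFin X w₀ (R - L') := by
  rcases deep_or_far X (nF := nF) x.1 hL hLR with h | h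
  · exact Or.inl h
  · right
    intro u hu
    rw [kitCube, Finset.mem_product] at hu
    exact h u.1 hu.1

end BoxProdZ2

end Transplant

end Summit.CriticalPhenomena.PercolationContinuityZ3.Theorems

end
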